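import Literature.AlgebraicGeometry.GroupSchemes.StageSaturateOfRightDivDense
import Literature.AlgebraicGeometry.GroupSchemes.StrictOpenChunkInstances
import Literature.AlgebraicGeometry.GroupSchemes.BirationalGroupLawFromShears
import Mathlib.AlgebraicGeometry.Morphisms.Smooth
import HarnessLib

/-!
# Artin's saturation step over a discrete valuation ring (the (W1) text `StageSaturate` instantiated)

Topic `Literature/AlgebraicGeometry/GroupSchemes`, namespace `Literature.AlgebraicGeometry.GroupSchemes`.  ONE
THEOREM (no definition, no named fact, no instance, no `sorry`).  Cell `hodgecm-mathlib`, road W (r₀), (W1) step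
(G3b) «StageSaturate» at `S := Spec R`, `R` a discrete valuation ring: the binder-free saturation theorem
`BirationalGroupLaw.toRationalMap_domain_eq_top_of_strict` (★, general base `S`, with the instance hypotheses
`[IsIntegral (𝒳 ⊗ 𝒳).left] [𝒱.left.IsSeparated] [UniversallyOpen 𝒳.hom] [IrreducibleSpace 𝒳.left]
[GeometricallyIrreducible 𝒳.hom]`) specialised to the standing hypotheses of the (W1) plan — `𝒳 → Spec R` SMOOTH with
geometrically irreducible fibres, `𝒱 → Spec R` separated — by deriving those instances: `𝒳 ×_R 𝒳 → Spec R` is smooth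
(★ `smooth_tensorObj_hom_of_smooth`) with geometrically irreducible fibres (★ `geometricallyIrreducible_tensorObj_hom`),
hence `𝒳 ×_R 𝒳` is integral (★ `isIntegral_left_of_smooth_of_geometricallyIrreducible`: regular over the regular `R`,
irreducible over the irreducible `Spec R`); `𝒳` is irreducible (Mathlib `GeometricallyIrreducible.irreducibleSpace`,
smooth ⇒ flat + locally of finite presentation ⇒ universally open, Mathlib `UniversallyOpen.of_flat`); `𝒱` is
separated (composite `𝒱 → Spec R → pt` of separated morphisms).  Statement otherwise VERBATIM ★
`toRationalMap_domain_eq_top_of_strict` (`hsec` = sections through every non-empty open of every fibre, `H` = Artin's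
«`V × x ⊂ W`» for every section, conclusion `dom (dom, mul ≫ j) = ⊤`).  This is [Artin1986NeronModels] §2, last
paragraph of the proof of Thm. (1.12), in the setting of (1.11)–(1.12) (`S` the spectrum of a discrete valuation
ring, `V` smooth with geometrically irreducible fibres); [EdixhovenRomagny] Assumptions 3.3 + Thm. 3.22.  HC_CM is
proved only modulo the 7 printed citations until rung 0 closes; banked leaf, no floor change.

## References
* [Artin1986NeronModels] M. Artin, *Néron models*, in Cornell–Silverman (eds.), *Arithmetic Geometry* (1986), §1
  (1.11)–(1.12) and §2, proof of Thm. (1.12), last paragraph (pp. 222–223).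
* [EdixhovenRomagny] B. Edixhoven, M. Romagny, *Group schemes out of birational group laws, Néron models*, Panor.
  Synthèses 47 (2015), Assumptions 3.3, Lemmas 3.19–3.21 and Thm. 3.22.
-/

noncomputable section

set_option backward.isDefEq.respectTransparency false

universe u

namespace Literature.AlgebraicGeometry.GroupSchemes

open CategoryTheory Limits _root_.AlgebraicGeometry MonoidalCategory CartesianMonoidalCategory TopologicalSpace
open Literature.NumberTheory.EllipticCurves

variable {R : Type u} [CommRing R] [IsDomain R] [IsDiscreteValuationRing R]
  {𝒳 𝒱 : Over (Spec (.of R))} [Smooth 𝒳.hom] [GeometricallyIrreducible 𝒳.hom] [IsSeparated 𝒱.hom]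
  (L : BirationalGroupLaw 𝒳) (j : 𝒳 ⟶ 𝒱)

/-- **Artin's saturation step over a discrete valuation ring** ([Artin1986NeronModels] §2, last paragraph of the
proof of Thm. (1.12), setting of (1.11)–(1.12); [EdixhovenRomagny] Assumptions 3.3 and Thm. 3.22): let `R` be a
discrete valuation ring, `𝒳 → Spec R` smooth with geometrically irreducible fibres, `L = (dom, mul)` a STRICT
birational group law on `𝒳`, `𝒱 → Spec R` separated and `j : 𝒳 → 𝒱` an `R`-morphism; assume sections of `𝒳` pass
through every non-empty open of every fibre (`hsec`) and that every slice `𝒳 × s` of a section `s` lies in the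
domain of definition of the rational map `f = (dom, mul ≫ j) : 𝒳 ×_R 𝒳 ⤏ 𝒱` (`H`, Artin's «`V × x ⊂ W`»).  Then
`dom f` is all of `𝒳 ×_R 𝒳`.  (★ `BirationalGroupLaw.toRationalMap_domain_eq_top_of_strict` with its instance
hypotheses derived from smoothness + geometric irreducibility over the discrete valuation ring.)
[cite: Artin1986NeronModels, §2, proof of Thm. (1.12), last paragraph (pp. 222–223)]
[cite: EdixhovenRomagny, Assumptions 3.3 and Thm. 3.22] -/
theorem BirationalGroupLaw.toRationalMap_domain_eq_top_of_strict_of_smooth (hL : L.IsStrict)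
    (hsec : ∀ (x : 𝒳.left) (Ω : 𝒳.left.Opens), x ∈ Ω →
      ∃ a : Spec (.of R) ⟶ 𝒳.left, a ≫ 𝒳.hom = 𝟙 (Spec (.of R)) ∧
        ∃ t : Spec (.of R), a.base t ∈ Ω ∧ 𝒳.hom.base (a.base t) = 𝒳.hom.base x)
    (H : ∀ (s : Spec (.of R) ⟶ 𝒳.left) (hs : s ≫ 𝒳.hom = 𝟙 (Spec (.of R))) (x : 𝒳.left),
      (lift (𝟙 𝒳) (Over.homMk (𝒳.hom ≫ s) (by rw [Category.assoc, hs, Category.comp_id]) : 𝒳 ⟶ 𝒳)).left.base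
          x ∈
        (Scheme.PartialMap.toRationalMap
          (⟨L.dom, L.dense_dom.dense, L.mul ≫ j.left⟩ : (𝒳 ⊗ 𝒳).left.PartialMap 𝒱.left)).domain) :
    (Scheme.PartialMap.toRationalMap
        (⟨L.dom, L.dense_dom.dense, L.mul ≫ j.left⟩ : (𝒳 ⊗ 𝒳).left.PartialMap 𝒱.left)).domain = ⊤ := by
  -- `𝒳 ×_R 𝒳 → Spec R` is smooth with geometrically irreducible fibres, hence `𝒳 ×_R 𝒳` is integral
  haveI : Smooth (𝒳 ⊗ 𝒳).hom := smooth_tensorObj_hom_of_smooth ‹_› ‹_›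
  haveI : GeometricallyIrreducible (𝒳 ⊗ 𝒳).hom := geometricallyIrreducible_tensorObj_hom 𝒳
  haveI : IsIntegral (𝒳 ⊗ 𝒳).left := isIntegral_left_of_smooth_of_geometricallyIrreducible (𝒳 ⊗ 𝒳)
  -- `𝒳` is irreducible: geometrically irreducible fibres over the irreducible `Spec R`, open structure map
  haveI : IrreducibleSpace ↑𝒳.left := GeometricallyIrreducible.irreducibleSpace 𝒳.hom 𝒳.hom.isOpenMap
  -- `𝒱` is separated: `𝒱 → Spec R` and `Spec R → pt` are
  haveI : 𝒱.left.IsSeparated := ⟨by rw [← terminal.comp_from 𝒱.hom]; infer_instance⟩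
  exact L.toRationalMap_domain_eq_top_of_strict j hL hsec H

end Literature.AlgebraicGeometry.GroupSchemes

end
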